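import Literature.NumberTheory.Sieve.GoldbachLinnikSeven
import Literature.NumberTheory.Sieve.RomanovTheorem
import HarnessLib

/-!
# Romanov's constant and the Linnik–Goldbach problem with two powers of two: Pintz's observation `d > 1/4 ⇒ K = 2`

Topic `Literature/NumberTheory/Sieve` (Romanov's theorem and its constant; companion of `RomanovTheorem.lean` and
`GoldbachLinnikSeven.lean`).  **THIS IS NOT A ROUTE TO GOLDBACH**; the file proves an elementary implication and
asserts nothing about the size of Romanov's constant.

Romanov's set is `𝓐 = {n : n = p + 2^k, p prime, k ≥ 1}` (the tree's `Romanov.romanovSet N = 𝓐 ∩ [0, N]`) and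
Romanov's constant is `d = liminf #(𝓐 ∩ [1, N])/N` (Johnston–Trudgian's / Elsholtz–Schlage-Puchta's / Chen–Sun's
normalisation; Habsieger–Roblot normalise by `N/2`).  J. Pintz (*A note on Romanov's constant*, 2006) observed that
`d > 1/4` would settle the Linnik–Goldbach problem with `K = 2` powers of two; Johnston–Trudgian (arXiv:2605.17825,
version 1, Proposition "Pintzobs") print the statement "If `d > 0.25`, then the Goldbach–Linnik problem holds with
`K = 2`" with the proof, verbatim: "If `d > 0.25` then `#{k ≤ n : k odd, k = p + 2^a} > n/4` for a suitably large even
value of `n`. It then follows that there exists a pair of odd integers `k` and `n − k` in `(0, n]` such that `r(k) > 0`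
and `r(n − k) > 0`. That is `k = p₁ + 2^{a₁}` and `n − k = p₂ + 2^{a₂}` and thus `n = p₁ + p₂ + 2^{a₁} + 2^{a₂}`."
(The section was dropped from their version 2.)  This file proves exactly that, in the tree's vocabulary
(`goldbach_linnik_with 2` of `GoldbachLinnikSeven.lean`):

* §0 `Romanov.romanovSet`: membership, monotonicity; an even member is `2 + 2^k`, so there are at most `log₂ N` of them.
* §1 `goldbach_linnik_two_of_card_odd_gt` (the printed five-line pigeonhole among the `n/2` odd residues, in full) and
  `goldbach_linnik_two_of_density_gt_quarter` (from `#romanovSet N ≥ δN` eventually, `δ > 1/4`, using `log₂ N = o(N)`).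
* §2 `goldbach_linnik_twice_of_card_odd_gt`: Johnston–Trudgian's generalisation (v1 Prop. 6), `d_k > 1/4 ⇒ K = 2k`, for any
  family of witness sets of odd numbers `p + 2^{e₁} + ⋯ + 2^{e_k}` (appended 2026-08-18).

The sequel `RomanovConstantPintzMethod.lean` types Pintz's second-moment method (by which every printed lower bound for
`d` is obtained) and `RomanovConstantLowerBounds.lean` certifies the printed numbers (all `< 1/4`; Pintz's threshold
for `K = 2` is a pair-sieve constant `C₁ ≤ 2.6`, far below the best known `6.7814`).  No definitions, no named facts.

## References

* J. Pintz, *A note on Romanov's constant*, Acta Math. Hungar. 112 (2006) 1–14, §1 (the observation; not held — quoted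
  through Johnston–Trudgian v1). [Pintz2006]
* D. R. Johnston, T. Trudgian, *An update on the Linnik–Goldbach (and Romanov) problem(s)*, arXiv:2605.17825, v1 §4.2
  Proposition (Pintzobs) with proof; Theorem 5 (`K = 2` if `C₁ ≤ 3.02` in their (romsieveeq)). [JohnstonTrudgian2026]
* M. B. Nathanson, *Additive Number Theory: The Classical Bases*, GTM 164 (1996), §7.6 (Romanov's theorem; the set `𝓐`).
  [Nathanson1996]
-/

noncomputable section

open Finset Filter

namespace Literature.NumberTheory.Sieve

namespace RomanovConstant

open Romanov

/-! ### §0 Romanov's set `{n ≤ N : n = p + 2^k, k ≥ 1}` -/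

/-- Membership in `Romanov.romanovSet N`. [cite: Nathanson1996, §7.6 Theorem 7.11] -/
theorem mem_romanovSet {N n : ℕ} :
    n ∈ romanovSet N ↔ n ≤ N ∧ ∃ p k : ℕ, p.Prime ∧ 1 ≤ k ∧ p + 2 ^ k = n := by
  classical
  unfold romanovSet
  rw [Finset.mem_filter, Finset.mem_range, Nat.lt_succ_iff]

/-- `romanovSet` is monotone in `N`. [folklore] -/
theorem romanovSet_mono {M N : ℕ} (h : M ≤ N) : romanovSet M ⊆ romanovSet N := by
  intro n hn
  rw [mem_romanovSet] at hn ⊢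
  exact ⟨hn.1.trans h, hn.2⟩

/-- An EVEN member of Romanov's set is `2 + 2^k` (its prime is `2`). [folklore] -/
theorem eq_two_add_pow_of_even {N n : ℕ} (hn : n ∈ romanovSet N) (he : Even n) :
    ∃ k : ℕ, 1 ≤ k ∧ 2 ^ k ≤ N ∧ n = 2 + 2 ^ k := by
  obtain ⟨hnN, p, k, hp, hk, rfl⟩ := mem_romanovSet.mp hn
  have h2k : Even (2 ^ k) := (Nat.even_pow' (by omega)).mpr even_two
  have hpe : Even p := (Nat.even_add.mp he).mpr h2k
  have hp2 : p = 2 := (Nat.Prime.even_iff hp).mp hpe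
  exact ⟨k, hk, by omega, by rw [hp2]⟩

/-- The even members of `romanovSet N` number at most `log₂ N`. [folklore] -/
theorem card_filter_even_le (N : ℕ) :
    ((romanovSet N).filter (fun n => Even n)).card ≤ Nat.log 2 N := by
  have hsub : (romanovSet N).filter (fun n => Even n) ⊆
      (Finset.Icc 1 (Nat.log 2 N)).image (fun k => 2 + 2 ^ k) := by
    intro n hn
    rw [Finset.mem_filter] at hn
    obtain ⟨k, hk1, hkN, rfl⟩ := eq_two_add_pow_of_even hn.1 hn.2
    exact Finset.mem_image.mpr ⟨k, Finset.mem_Icc.mpr ⟨hk1, Nat.le_log_of_pow_le (by norm_num) hkN⟩, rfl⟩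
  calc ((romanovSet N).filter (fun n => Even n)).card
      ≤ ((Finset.Icc 1 (Nat.log 2 N)).image (fun k => 2 + 2 ^ k)).card := Finset.card_le_card hsub
    _ ≤ (Finset.Icc 1 (Nat.log 2 N)).card := Finset.card_image_le
    _ = Nat.log 2 N := by simp

/-- `#romanovSet N ≤ #(odd members) + log₂ N`. [folklore] -/
theorem card_romanovSet_le_odd_add_log (N : ℕ) :
    (romanovSet N).card ≤ ((romanovSet N).filter (fun n => Odd n)).card + Nat.log 2 N := by
  have h := Finset.card_filter_add_card_filter_not (s := romanovSet N) (fun n => Odd n)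
  have he : ((romanovSet N).filter (fun n => ¬ Odd n)).card ≤ Nat.log 2 N := by
    have : (romanovSet N).filter (fun n => ¬ Odd n) = (romanovSet N).filter (fun n => Even n) := by
      refine Finset.filter_congr (fun n _ => ?_)
      exact Nat.not_odd_iff_even
    rw [this]
    exact card_filter_even_le N
  omega

/-! ### §1 Pintz's observation: `d > 1/4` gives the Linnik–Goldbach statement with `K = 2` -/

/-- A finite set of ODD numbers `≤ n`, `n` even, has at most `n/2` elements (inject `k ↦ ⌊k/2⌋` into `[0, n/2)`).
[folklore] -/
theorem card_le_half_of_odd {n : ℕ} (hn : Even n) (S : Finset ℕ) (hS : ∀ k ∈ S, Odd k ∧ k ≤ n) :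
    (S.card : ℝ) ≤ (n : ℝ) / 2 := by
  have hinj : S.card ≤ (Finset.range (n / 2)).card := by
    refine Finset.card_le_card_of_injOn (fun k => k / 2) (fun k hk => ?_) (fun k hk k' hk' hkk' => ?_)
    · obtain ⟨hko, hkn⟩ := hS k (Finset.mem_coe.mp hk)
      rw [Finset.mem_coe, Finset.mem_range]
      obtain ⟨m, rfl⟩ := hn
      obtain ⟨j, rfl⟩ := hko
      show (2 * j + 1) / 2 < (m + m) / 2
      omega
    · obtain ⟨hko, -⟩ := hS k (Finset.mem_coe.mp hk)
      obtain ⟨hko', -⟩ := hS k' (Finset.mem_coe.mp hk')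
      obtain ⟨j, rfl⟩ := hko
      obtain ⟨j', rfl⟩ := hko'
      simp only at hkk'
      omega
  rw [Finset.card_range] at hinj
  calc (S.card : ℝ) ≤ ((n / 2 : ℕ) : ℝ) := by exact_mod_cast hinj
    _ ≤ (n : ℝ) / 2 := Nat.cast_div_le

/-- **Pintz's observation** (Pintz 2006; Johnston–Trudgian v1, Proposition "Pintzobs", whose five-line proof is
reproduced): if for every sufficiently large even `n` more than `n/4` of the odd numbers `k ≤ n` are of the form
`p + 2^a`, then every sufficiently large even `n` is `p₁ + p₂ + 2^{a₁} + 2^{a₂}` — the pairs `k`, `n − k` of odd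
numbers cannot all avoid Romanov's set twice, by pigeonhole among the `n/2` odd residues.
[cite: JohnstonTrudgian2026, v1 §4.2 Proposition (Pintzobs) and its proof] [cite: Pintz2006, §1 (observation)] -/
theorem goldbach_linnik_two_of_card_odd_gt
    (h : ∃ N₀ : ℕ, ∀ n : ℕ, N₀ ≤ n → Even n →
      (n : ℝ) / 4 < (((romanovSet n).filter (fun k => Odd k)).card : ℝ)) :
    goldbach_linnik_with 2 := by
  classical
  obtain ⟨N₀, hN₀⟩ := h
  refine ⟨N₀, fun n hn hE => ?_⟩
  set A : Finset ℕ := (romanovSet n).filter (fun k => Odd k) with hAdef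
  have hAcard : (n : ℝ) / 4 < A.card := hN₀ n hn hE
  have hAmem : ∀ k ∈ A, Odd k ∧ k ≤ n ∧ ∃ p a : ℕ, p.Prime ∧ 1 ≤ a ∧ p + 2 ^ a = k := by
    intro k hk
    rw [hAdef, Finset.mem_filter, mem_romanovSet] at hk
    exact ⟨hk.2, hk.1.1, hk.1.2⟩
  set B : Finset ℕ := A.image (fun k => n - k) with hBdef
  have hBcard : B.card = A.card := by
    refine Finset.card_image_of_injOn (fun k hk k' hk' hkk' => ?_)
    have h1 := (hAmem k (Finset.mem_coe.mp hk)).2.1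
    have h2 := (hAmem k' (Finset.mem_coe.mp hk')).2.1
    have hkk'' : n - k = n - k' := hkk'
    omega
  have hU : ∀ k ∈ A ∪ B, Odd k ∧ k ≤ n := by
    intro k hk
    rcases Finset.mem_union.mp hk with hk | hk
    · exact ⟨(hAmem k hk).1, (hAmem k hk).2.1⟩
    · obtain ⟨k', hk', rfl⟩ := Finset.mem_image.mp hk
      obtain ⟨hko, hkn, -⟩ := hAmem k' hk'
      exact ⟨Nat.Even.sub_odd hkn hE hko, Nat.sub_le n k'⟩
  have hUcard : ((A ∪ B).card : ℝ) ≤ (n : ℝ) / 2 := card_le_half_of_odd hE (A ∪ B) hU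
  have hIcard : 0 < (A ∩ B).card := by
    have h := Finset.card_inter_add_card_union A B
    rw [hBcard] at h
    have h' : ((A ∩ B).card : ℝ) + ((A ∪ B).card : ℝ) = A.card + A.card := by exact_mod_cast h
    have : (0 : ℝ) < (A ∩ B).card := by linarith
    exact_mod_cast this
  obtain ⟨k, hk⟩ := Finset.card_pos.mp hIcard
  rw [Finset.mem_inter] at hk
  obtain ⟨-, -, p, a, hp, -, hpa⟩ := hAmem k hk.1
  obtain ⟨k', hk', hkk'⟩ := Finset.mem_image.mp hk.2
  obtain ⟨-, hk'n, q, b, hq, -, hqb⟩ := hAmem k' hk'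
  have hnk : n = k + k' := by omega
  refine ⟨p, q, 2, ![a, b], hp, hq, le_rfl, ?_⟩
  simp only [Fin.sum_univ_two, Matrix.cons_val_zero, Matrix.cons_val_one]
  rw [hnk, ← hpa, ← hqb]
  ring

/-- **Pintz's observation, density form**: if Romanov's set has `#(romanovSet N) ≥ δN` for all large `N` with some
`δ > 1/4` (i.e. Romanov's constant exceeds `1/4`), then `goldbach_linnik_with 2`.  (The even members `2 + 2^k` are
`≤ log₂ N = o(N)` in number, so the odd members alone exceed `N/4`.)
[cite: JohnstonTrudgian2026, v1 §4.2 Proposition (Pintzobs): "If d > 0.25, then the Goldbach–Linnik problem holds with K = 2"]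
[cite: Pintz2006, §1] -/
theorem goldbach_linnik_two_of_density_gt_quarter {δ : ℝ} (hδ : 1 / 4 < δ)
    (h : ∀ᶠ N : ℕ in atTop, δ * N ≤ ((romanovSet N).card : ℝ)) : goldbach_linnik_with 2 := by
  classical
  have hc : 0 < (δ - 1 / 4) / 2 * Real.log 2 := by
    have := Real.log_pos one_lt_two
    nlinarith
  -- `log x ≤ c x` eventually (real), transported to `ℕ`
  have hlog : ∀ᶠ N : ℕ in atTop, (Nat.log 2 N : ℝ) ≤ (δ - 1 / 4) / 2 * N := by
    have h1 : ∀ᶠ x : ℝ in atTop, ‖Real.log x‖ ≤ (δ - 1 / 4) / 2 * Real.log 2 * ‖x‖ :=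
      Real.isLittleO_log_id_atTop.def hc
    have h2 : ∀ᶠ N : ℕ in atTop, ‖Real.log (N : ℝ)‖ ≤ (δ - 1 / 4) / 2 * Real.log 2 * ‖(N : ℝ)‖ :=
      tendsto_natCast_atTop_atTop.eventually h1
    filter_upwards [h2, Filter.eventually_ge_atTop 1] with N hN hN1
    have hl2 : 0 < Real.log 2 := Real.log_pos one_lt_two
    have hN0 : N ≠ 0 := by omega
    have hlogN : 0 ≤ Real.log (N : ℝ) := Real.log_nonneg (by exact_mod_cast hN1)
    rw [Real.norm_of_nonneg hlogN, Real.norm_of_nonneg (Nat.cast_nonneg N)] at hN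
    have h3 : (Nat.log 2 N : ℝ) ≤ Real.log N / Real.log 2 := natLog_two_le_log_div hN0
    have h4 : Real.log (N : ℝ) / Real.log 2 ≤ (δ - 1 / 4) / 2 * N := by
      rw [div_le_iff₀ hl2]
      linarith
    linarith
  obtain ⟨N₀, hN₀⟩ := Filter.eventually_atTop.mp (h.and hlog)
  refine goldbach_linnik_two_of_card_odd_gt ⟨max N₀ 1, fun n hn hE => ?_⟩
  have hn0 : N₀ ≤ n := (le_max_left _ _).trans hn
  have hn1 : 1 ≤ n := (le_max_right _ _).trans hn
  have hnpos : (0 : ℝ) < n := by exact_mod_cast hn1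
  obtain ⟨hdens, hlg⟩ := hN₀ n hn0
  have hsplit : ((romanovSet n).card : ℝ) ≤
      (((romanovSet n).filter (fun k => Odd k)).card : ℝ) + (Nat.log 2 n : ℝ) := by
    exact_mod_cast card_romanovSet_le_odd_add_log n
  nlinarith

/-! ### §2 Johnston–Trudgian's generalisation (v1 Proposition 6): `d_k > 1/4 ⇒ K = 2k` -/

/-- **Generalised observation** (Johnston–Trudgian v1, Proposition 6: "If `d_k > 0.25`, then the Goldbach–Linnik problem holds
with `K = 2k`", where `d_k` is the lower density of the integers `p + 2^{a₁} + ⋯ + 2^{a_k}`): if for every sufficiently large even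
`n` some set `S n` of more than `n/4` ODD numbers `m ≤ n`, each of the form `p + Σ_{i<k} 2^{eᵢ}` with `p` prime, is given, then
every sufficiently large even `n` is a sum of two primes and `k + k` powers of two.  Same pigeonhole as
`goldbach_linnik_two_of_card_odd_gt` (which is the case `k = 1` with `S n` the odd members of `romanovSet n`).
[cite: JohnstonTrudgian2026, v1 §5.3 Proposition 6 (generalising Pintz's observation)] -/
theorem goldbach_linnik_twice_of_card_odd_gt (k : ℕ) (S : ℕ → Finset ℕ)
    (hS : ∀ n, ∀ m ∈ S n, Odd m ∧ m ≤ n ∧ ∃ (p : ℕ) (e : Fin k → ℕ), p.Prime ∧ p + ∑ i, 2 ^ e i = m)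
    (h : ∃ N₀ : ℕ, ∀ n : ℕ, N₀ ≤ n → Even n → (n : ℝ) / 4 < ((S n).card : ℝ)) :
    goldbach_linnik_with (k + k) := by
  classical
  obtain ⟨N₀, hN₀⟩ := h
  refine ⟨N₀, fun n hn hE => ?_⟩
  set A : Finset ℕ := S n with hAdef
  have hAcard : (n : ℝ) / 4 < A.card := hN₀ n hn hE
  have hAmem : ∀ m ∈ A, Odd m ∧ m ≤ n ∧ ∃ (p : ℕ) (e : Fin k → ℕ), p.Prime ∧ p + ∑ i, 2 ^ e i = m :=
    hS n
  set B : Finset ℕ := A.image (fun m => n - m) with hBdef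
  have hBcard : B.card = A.card := by
    refine Finset.card_image_of_injOn (fun m hm m' hm' hmm' => ?_)
    have h1 := (hAmem m (Finset.mem_coe.mp hm)).2.1
    have h2 := (hAmem m' (Finset.mem_coe.mp hm')).2.1
    have hmm'' : n - m = n - m' := hmm'
    omega
  have hU : ∀ m ∈ A ∪ B, Odd m ∧ m ≤ n := by
    intro m hm
    rcases Finset.mem_union.mp hm with hm | hm
    · exact ⟨(hAmem m hm).1, (hAmem m hm).2.1⟩
    · obtain ⟨m', hm', rfl⟩ := Finset.mem_image.mp hm
      obtain ⟨hmo, hmn, -⟩ := hAmem m' hm'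
      exact ⟨Nat.Even.sub_odd hmn hE hmo, Nat.sub_le n m'⟩
  have hUcard : ((A ∪ B).card : ℝ) ≤ (n : ℝ) / 2 := card_le_half_of_odd hE (A ∪ B) hU
  have hIcard : 0 < (A ∩ B).card := by
    have h := Finset.card_inter_add_card_union A B
    rw [hBcard] at h
    have h' : ((A ∩ B).card : ℝ) + ((A ∪ B).card : ℝ) = A.card + A.card := by exact_mod_cast h
    have : (0 : ℝ) < (A ∩ B).card := by linarith
    exact_mod_cast this
  obtain ⟨m, hm⟩ := Finset.card_pos.mp hIcard
  rw [Finset.mem_inter] at hm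
  obtain ⟨-, -, p, e, hp, hpe⟩ := hAmem m hm.1
  obtain ⟨m', hm', hmm'⟩ := Finset.mem_image.mp hm.2
  obtain ⟨-, hm'n, q, e', hq, hqe⟩ := hAmem m' hm'
  have hnm : n = m + m' := by omega
  refine ⟨p, q, k + k, Fin.append e e', hp, hq, le_rfl, ?_⟩
  rw [Fin.sum_univ_add]
  simp only [Fin.append_left, Fin.append_right]
  rw [hnm, ← hpe, ← hqe]
  ring

end RomanovConstant

end Literature.NumberTheory.Sieve
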